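import Mathlib.Geometry.Manifold.VectorField.Pullback
import Literature.Geometry.Lorentzian.KillingHorizonShadowAlong
import Literature.Geometry.Lorentzian.EinsteinTensorNaturality
import Literature.Geometry.Lorentzian.ImmersedChartRicci
import Literature.Geometry.Lorentzian.ChartMetricCoord
import Literature.Geometry.Lorentzian.KerrKillingTangency
import Literature.Geometry.Lorentzian.SpacetimeLocalConvergence
import Literature.Geometry.Lorentzian.SpacetimeMetricInCoordsCalculus
import Literature.Geometry.Manifold.InjOnLocalDiffeomorphInverse
import HarnessLib

/-!
# Crux `GapExhaustion` (stmt-FinalStateConjecture-10808), line `photon-shell-pseudoconvexity`: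
# stub (N-5b) `stub_killing_pushforward_at` — the chart bridge run backwards: a solution of the
# COORDINATE Killing equation of the pulled-back components, pushed forward through an injective
# immersed chart, satisfies the manifold Killing equation at the image point

Route `BartnikGapSettling`; helper (`--supports stmt-FinalStateConjecture-10808`) landing the
registered glue stub (N-5b) of line lead c10. The outward Killing-extension sweep (S5 of the node
`EternalSilentNearKerrIsKerr`) produces, on an open subset `W` of the domain of the eternal star
chart `Φ : E4 → 𝓢.carrier` (smooth, injective, with injective differential on `W`), a solution
`k : E4 → E4` of the coordinate Killing equation
`DG(y)(k y)(v, w) + G y (Dk(y) v) w + G y v (Dk(y) w) = 0` of the components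
`G = 𝓢.metricInCoords Φ`, whereas the node speaks of Killing fields of the spacetime metric on
subsets of `Φ '' W` (`IsKillingFieldOn`). The pushed-forward section is
`S p := dΦ_{Φ⁻¹ p} (k (Φ⁻¹ p))` with `Φ⁻¹ = invFunOn Φ W`; its smoothness on the open set `Φ '' W`
is the neighbouring stub (N-5a) and enters here as a hypothesis. This file proves the Killing
equation `g(∇_{Y₀} S, Z₀) + g(Y₀, ∇_{Z₀} S) = 0` of `g = 𝓢.metric` at `Φ y`, for all
`Y₀, Z₀ ∈ T_{Φ y} 𝓢`, from the coordinate equation at `y ∈ W` — the converse, at a point, of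
`stub_killingCoord_of_isKillingFieldOn_at` (G5-A2).

Proof: on the open submanifold `A = ⟨W, _⟩ : Opens E4` the pullback metric `g' = (Φ ∘ val)^* g`
(`PseudoRiemannianMetric.comap`) has representative `G` (`val_comap_immersedChart`), and the
pulled-back section `K' = mpullback (Φ ∘ val) S` has representative `k` on `A`
(`invFunOn Φ W (Φ z) = z` and `(dΦ_z)⁻¹ ∘ dΦ_z = id` for the invertible differential). The
Levi-Civita connection of `g'` in coordinates (`OpensChart.leviCivita_apply_eq`:
`∇'_{X₀} K' = Dk(y) X₀ + Γ_y(k y) X₀`) and the pointwise identity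
`G(A v + Γ(Z) v, w) + G(v, A w + Γ(Z) w) = DG(Z)(v, w) + G(A v, w) + G(v, A w)` (the Koszul
formula for `Γ`, `two_mul_val_christoffel`; this is the algebra of O'Neill 1983, Ch. 9,
Prop. 9.25, `Killing ⇔ 𝓛_X g = 0`) turn the coordinate equation into the vanishing of the Killing
form of `K'` for `g'` at `u = ⟨y, _⟩`; by naturality of the Killing form under the local isometry
`(A, g') → (𝓢, g)` (`val_leviCivita_mpullback_add`, O'Neill 1983, Ch. 3, Prop. 3.59) this is the
Killing form of `S` for `g` at `Φ y` on the pushed-forward vectors `dΦ_y Y₁`, `dΦ_y Z₁`, and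
`dΦ_y` is onto (`mfderiv_bijective_of_injective`).
-/

noncomputable section

set_option maxSynthPendingDepth 3

-- D-0017: single-problem summit, `Summit.<S>.<S>.…` by design (cf. lakefile `weak.linter.dupNamespace`).
set_option linter.dupNamespace false

namespace Summit.FinalStateConjecture.FinalStateConjecture.Theorems

open Set Function Bundle VectorField TopologicalSpace
open Literature.Geometry.Lorentzian Literature.Geometry.Lorentzian.MetricCoord
open scoped Manifold ContDiff Topology

/-- **The Killing equation in coordinates, pointwise identity.** For a metric `g` on
`U : Opens E4` with components `G` (`g.val y = G y`), a point `x : U`, a vector `Z`, and a linear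
map `A : E4 →L[ℝ] E4`,
`G_x(A v + Γ_x(Z) v, w) + G_x(v, A w + Γ_x(Z) w) = DG_x(Z)(v, w) + G_x(A v, w) + G_x(v, A w)`:
the metric pairing of `∇_v X = A v + Γ(Z) v` (`Z = X x`, `A = DXf_x`) against `w`, symmetrised,
is the coordinate Lie derivative `(𝓛_X g)(v, w)`, because `g(Γ(Z) v, w) + g(v, Γ(Z) w) = ∂_Z g(v, w)`
by the Koszul formula for `Γ` (`two_mul_val_christoffel`). O'Neill 1983, Ch. 9, Prop. 9.25; Wald
1984, (C.3.1). [cite: ONeill1983, Ch. 9, Prop. 9.25] -/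
private theorem killPush_val_christoffel_add_eq {U : Opens E4}
    {g : PseudoRiemannianMetric 𝓘(ℝ, E4) ∞ E4 (TangentSpace 𝓘(ℝ, E4) : U → Type _)}
    {G : E4 → E4 →L[ℝ] E4 →L[ℝ] ℝ} (hG : ∀ y : U, g.val y = G y) (x : U)
    (hGx : DifferentiableAt ℝ G x) (Z : E4) (A : E4 →L[ℝ] E4) (v w : E4) :
    G x (A v + OpensChart.christoffel g G x Z v) w + G x v (A w + OpensChart.christoffel g G x Z w) =
      fderiv ℝ G x Z v w + G x (A v) w + G x v (A w) := by
  rw [map_add, _root_.add_apply, map_add]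
  have h2 := OpensChart.two_mul_val_christoffel (g := g) (G := G) x Z v w
  have h3 := OpensChart.two_mul_val_christoffel (g := g) (G := G) x Z w v
  rw [OpensChart.koszulForm_apply, hG x] at h2 h3
  have hsym : ∀ P Q : E4, G x P Q = G x Q P := fun P Q ↦ by
    have := g.symm x P Q; rwa [hG x] at this
  have hs := hsym v (OpensChart.christoffel g G x Z w)
  have hs1 := OpensChart.fderiv_repr_symm hG x hGx v Z w
  have hs2 := OpensChart.fderiv_repr_symm hG x hGx w Z v
  have hs3 := OpensChart.fderiv_repr_symm hG x hGx Z w v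
  linear_combination (1 / 2 : ℝ) * h2 + (1 / 2 : ℝ) * h3 + hs + (1 / 2 : ℝ) * hs1 +
    (1 / 2 : ℝ) * hs2 + (1 / 2 : ℝ) * hs3

/-- **Stub (N-5b) of the line `photon-shell-pseudoconvexity` (crux `GapExhaustion`,
stmt-FinalStateConjecture-10808) — coordinate Killing ⇒ manifold Killing through an injective
immersed chart, at a point.** Let `Φ : E4 → 𝓢.carrier` be smooth and injective on the open set
`W`, with injective differential there, let `k : E4 → E4`, and suppose the pushed-forward section
`S p = dΦ_{Φ⁻¹ p} (k (Φ⁻¹ p))` (`Φ⁻¹ = invFunOn Φ W`) is a smooth section of `T𝓢` on `Φ '' W`.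
If at `y ∈ W` the field `k` is differentiable and satisfies the coordinate Killing equation of
`G = 𝓢.metricInCoords Φ`, `DG(y)(k y)(v, w) + G y (Dk(y) v) w + G y v (Dk(y) w) = 0` for all
`v, w`, then `S` satisfies the Killing equation of `𝓢.metric` at `Φ y`:
`g(∇_{Y₀} S, Z₀) + g(Y₀, ∇_{Z₀} S) = 0` for all `Y₀, Z₀ ∈ T_{Φ y} 𝓢` (O'Neill 1983, Ch. 9,
Prop. 9.25, read through the local isometry `(W, Φ^*g) → (𝓢, g)`, Ch. 3, Prop. 3.59).
[cite: ONeill1983, Ch. 9, Prop. 9.25] -/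
theorem stub_killing_pushforward_at :
    ∀ (𝓢 : Spacetime.{0} 4) [𝓢.metric.HasLeviCivita] (Φ : E4 → 𝓢.carrier) (W : Set E4)
      (k : E4 → E4),
      IsOpen W → ContMDiffOn 𝓘(ℝ, E4) (𝓡 4) ∞ Φ W →
      (∀ y ∈ W, Function.Injective (mfderiv 𝓘(ℝ, E4) (𝓡 4) Φ y)) → InjOn Φ W →
      ContMDiffOn (𝓡 4) ((𝓡 4).prod 𝓘(ℝ, E4)) ∞
        (fun p : 𝓢.carrier ↦ (Bundle.TotalSpace.mk' E4 p
          (mfderiv 𝓘(ℝ, E4) (𝓡 4) Φ (invFunOn Φ W p) (k (invFunOn Φ W p)) : TangentSpace (𝓡 4) p)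
            : TangentBundle (𝓡 4) 𝓢.carrier)) (Φ '' W) →
      ∀ y ∈ W, DifferentiableAt ℝ k y →
        (∀ v w : E4, fderiv ℝ (𝓢.metricInCoords Φ) y (k y) v w
          + 𝓢.metricInCoords Φ y (fderiv ℝ k y v) w + 𝓢.metricInCoords Φ y v (fderiv ℝ k y w) = 0) →
        ∀ Y₀ Z₀ : TangentSpace (𝓡 4) (Φ y),
          𝓢.metric.val (Φ y)
              (𝓢.metric.toPseudoRiemannianMetric.leviCivita
                (fun p : 𝓢.carrier ↦
                  (mfderiv 𝓘(ℝ, E4) (𝓡 4) Φ (invFunOn Φ W p) (k (invFunOn Φ W p)) :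
                    TangentSpace (𝓡 4) p)) (Φ y) Y₀) Z₀
            + 𝓢.metric.val (Φ y) Y₀
              (𝓢.metric.toPseudoRiemannianMetric.leviCivita
                (fun p : 𝓢.carrier ↦
                  (mfderiv 𝓘(ℝ, E4) (𝓡 4) Φ (invFunOn Φ W p) (k (invFunOn Φ W p)) :
                    TangentSpace (𝓡 4) p)) (Φ y) Z₀) = 0 := by
  intro 𝓢 _ Φ W k hW hΦ hinj' hinj hS y hy hk hcoord
  -- the open submanifold `A` and the pullback metric `g' = (Φ ∘ val)^* g` on it
  set A : Opens E4 := ⟨W, hW⟩ with hAdef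
  have hΦA : ContMDiffOn 𝓘(ℝ, E4) (𝓡 4) ∞ Φ A := hΦ
  have hinjA : ∀ z ∈ A, Function.Injective (mfderiv 𝓘(ℝ, E4) (𝓡 4) Φ z) := hinj'
  set g := 𝓢.metric.toPseudoRiemannianMetric with hgdef
  set g' := g.comap PseudoRiemannianMetric.contMDiff_pullbackBilin_holds
    (Φ ∘ (Subtype.val : A → E4)) (contMDiff_immersedChart_comp_val hΦA)
    (injective_mfderiv_immersedChart_comp_val hΦA hinjA) rfl with hg'def
  haveI := g'.hasLeviCivita
  -- the representative of `g'` is `G = metricInCoords Φ`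
  set G : E4 → E4 →L[ℝ] E4 →L[ℝ] ℝ := 𝓢.metricInCoords Φ with hGdef
  have hrepr : ∀ z : A, g'.val z = G z := fun z ↦ val_comap_immersedChart g hΦA hinjA rfl z
  -- the pushed-forward section `S` and its pullback `K'` over `A`, with representative `k`
  set S : Π p : 𝓢.carrier, TangentSpace (𝓡 4) p := fun p ↦
    (mfderiv 𝓘(ℝ, E4) (𝓡 4) Φ (invFunOn Φ W p) (k (invFunOn Φ W p)) : TangentSpace (𝓡 4) p)
    with hSdef
  set K' : Π z : A, TangentSpace 𝓘(ℝ, E4) z :=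
    mpullback 𝓘(ℝ, E4) (𝓡 4) (Φ ∘ (Subtype.val : A → E4)) S with hK'def
  have key : ∀ x x' : E4, x = x' →
      (mfderiv 𝓘(ℝ, E4) (𝓡 4) Φ x (k x) : E4) = mfderiv 𝓘(ℝ, E4) (𝓡 4) Φ x' (k x') := by
    rintro _ _ rfl
    rfl
  have hK' : ∀ z : A, K' z = k z := by
    intro z
    have hd : MDifferentiableAt 𝓘(ℝ, E4) (𝓡 4) Φ (z : E4) :=
      ((hΦ z.1 z.2).contMDiffAt (hW.mem_nhds z.2)).mdifferentiableAt (by simp)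
    have hinv : (mfderiv 𝓘(ℝ, E4) (𝓡 4) Φ (z : E4)).IsInvertible :=
      PseudoRiemannianMetric.isInvertible_mfderiv_of_injective (Φ := Φ) rfl (hinj' z.1 z.2)
    have hz : invFunOn Φ W (Φ z) = z := Literature.Geometry.Manifold.invFunOn_apply hinj z.2
    simp only [hK'def, mpullback_apply, Function.comp_apply]
    rw [𝓢.mfderiv_comp_subtypeVal_opens z hd]
    change (mfderiv 𝓘(ℝ, E4) (𝓡 4) Φ (z : E4)).inverse
        (mfderiv 𝓘(ℝ, E4) (𝓡 4) Φ (invFunOn Φ W (Φ z)) (k (invFunOn Φ W (Φ z)))) = k z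
    rw [key _ _ hz]
    exact hinv.inverse_apply_self _
  -- the image is open, so `S` is differentiable at `Φ y` as a bundle section
  have hopen : IsOpen (Φ '' W) :=
    Literature.Geometry.Manifold.isOpen_image_of_bijective_mfderiv hW hΦ fun z hz ↦
      mfderiv_bijective_of_injective (hinj' z hz) rfl
  set u : A := ⟨y, hy⟩ with hudef
  have hSd : MDifferentiableAt (𝓡 4) (𝓡 4).tangent
      (fun x ↦ (TotalSpace.mk' E4 x (S x) : TangentBundle (𝓡 4) 𝓢.carrier))
      ((Φ ∘ (Subtype.val : A → E4)) u) :=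
    (hS.contMDiffAt (hopen.mem_nhds (mem_image_of_mem Φ hy))).mdifferentiableAt (by simp)
  -- naturality of the Killing form under the local isometry `(A, g') → (𝓢, g)`
  have hnat : ∀ Y₁ Z₁ : E4,
      g'.val u (g'.leviCivita K' u Y₁) Z₁ + g'.val u Y₁ (g'.leviCivita K' u Z₁) =
        g.val ((Φ ∘ (Subtype.val : A → E4)) u)
            (g.leviCivita S ((Φ ∘ (Subtype.val : A → E4)) u)
              (mfderiv 𝓘(ℝ, E4) (𝓡 4) (Φ ∘ (Subtype.val : A → E4)) u Y₁))
            (mfderiv 𝓘(ℝ, E4) (𝓡 4) (Φ ∘ (Subtype.val : A → E4)) u Z₁) +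
          g.val ((Φ ∘ (Subtype.val : A → E4)) u)
            (mfderiv 𝓘(ℝ, E4) (𝓡 4) (Φ ∘ (Subtype.val : A → E4)) u Y₁)
            (g.leviCivita S ((Φ ∘ (Subtype.val : A → E4)) u)
              (mfderiv 𝓘(ℝ, E4) (𝓡 4) (Φ ∘ (Subtype.val : A → E4)) u Z₁)) := fun Y₁ Z₁ ↦
    g.val_leviCivita_mpullback_add PseudoRiemannianMetric.contMDiff_pullbackBilin_holds
      (contMDiff_immersedChart_comp_val hΦA) (injective_mfderiv_immersedChart_comp_val hΦA hinjA)
      rfl hSd Y₁ Z₁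
  -- the Levi-Civita connection of `g'` in coordinates, and the coordinate Killing equation
  have hkd : DifferentiableAt ℝ k (u : E4) := hk
  have hlc : ∀ X₀ : E4, g'.leviCivita K' u X₀ =
      fderiv ℝ k u X₀ + OpensChart.christoffel g' G u (K' u) X₀ := fun X₀ ↦
    OpensChart.leviCivita_apply_eq hrepr u hK' hkd X₀
  have hGd : DifferentiableAt ℝ G (u : E4) := OpensChart.differentiableAt_repr hrepr u
  have hzero : ∀ Y₁ Z₁ : E4,
      g'.val u (g'.leviCivita K' u Y₁) Z₁ + g'.val u Y₁ (g'.leviCivita K' u Z₁) = 0 := by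
    intro Y₁ Z₁
    rw [hlc Y₁, hlc Z₁, hK' u, hrepr u]
    exact (killPush_val_christoffel_add_eq hrepr u hGd (k u) (fderiv ℝ k u) Y₁ Z₁).trans
      (hcoord Y₁ Z₁)
  -- back on `𝓢`: the Killing form of `S` vanishes on pushed-forward vectors
  have hd : MDifferentiableAt 𝓘(ℝ, E4) (𝓡 4) Φ y :=
    ((hΦ y hy).contMDiffAt (hW.mem_nhds hy)).mdifferentiableAt (by simp)
  have hmf : mfderiv 𝓘(ℝ, E4) (𝓡 4) (Φ ∘ (Subtype.val : A → E4)) u =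
      mfderiv 𝓘(ℝ, E4) (𝓡 4) Φ y := 𝓢.mfderiv_comp_subtypeVal_opens u hd
  have hpush : ∀ Y₁ Z₁ : E4,
      g.val (Φ y) (g.leviCivita S (Φ y) (mfderiv 𝓘(ℝ, E4) (𝓡 4) Φ y Y₁))
          (mfderiv 𝓘(ℝ, E4) (𝓡 4) Φ y Z₁) +
        g.val (Φ y) (mfderiv 𝓘(ℝ, E4) (𝓡 4) Φ y Y₁)
          (g.leviCivita S (Φ y) (mfderiv 𝓘(ℝ, E4) (𝓡 4) Φ y Z₁)) = 0 := by
    intro Y₁ Z₁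
    have h := hnat Y₁ Z₁
    rw [hzero Y₁ Z₁, hmf] at h
    exact h.symm
  -- `dΦ_y` is onto
  intro Y₀ Z₀
  obtain ⟨Y₁, rfl⟩ := (mfderiv_bijective_of_injective (hinj' y hy) rfl).2 Y₀
  obtain ⟨Z₁, rfl⟩ := (mfderiv_bijective_of_injective (hinj' y hy) rfl).2 Z₀
  exact hpush Y₁ Z₁

end Summit.FinalStateConjecture.FinalStateConjecture.Theorems

end
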